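import Summits.ABC.StewartYu.PadicG3RecordG
import HarnessLib

/-!
# Cell abc-stewartyu, crux `Y07Odd` (stmt-ABC-19658), line `gen3-slab-odd`: the parameter record of the odd-`p` frame built from the datum

`Summits/ABC/StewartYu/PadicG3ParOdd.lean` — cell `abc-stewartyu` (seat p2-g4, F-odd lead).  One definition and its field lemmas; no named fact.
`parOdd p V Vmax W … : PadicG3Par n` — prime `p ≥ 3`, heights `A := V` (`V ≥ 1 ≥ log 2`), `Amax := Vmax`, coefficient logarithm `W`,
no saturation (`Nq := 1`), `K₀ := p − 1` twist classes (the full group `μ_{p−1} ⊂ ℤ_p^×`), supernormality exponent `θ₀ := 1/2`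
(the frame's radius is `p^{m} √p = p^{m + 1/2}`, so the record's gain `G = (m + θ₀) log p` is the frame's gain per zero).

References: K. Yu, Acta Math. 211 (2013) §7; cell pages HOME/p1/K-M3.2-m0-branch.md.
-/

noncomputable section

namespace Summit.ABC.StewartYu

/-- **The parameter record of the odd-`p` frame.** [folklore] -/
def parOdd (p : ℕ) (hp : 3 ≤ p) {n : ℕ} (hn : 1 ≤ n) (V : Fin n → ℝ) (Vmax W : ℝ) (hV1 : ∀ j, 1 ≤ V j) (hVm : ∀ j, V j ≤ Vmax)
    (hW : 1 ≤ W) : PadicG3Par n where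
  p := p
  A := V
  Amax := Vmax
  W := W
  Nq := 1
  K₀ := p - 1
  θ₀ := 1 / 2
  hn := hn
  hp := by omega
  hA := fun j => le_trans (le_trans (le_of_lt Real.log_two_lt_d9) (by norm_num)) (hV1 j)
  hAmax := hVm
  hAmax1 := le_trans (hV1 ⟨0, hn⟩) (hVm ⟨0, hn⟩)
  hW := hW
  hNq := le_rfl
  hK₀ := by omega
  hK₀p := Nat.sub_le p 1
  hθ₀ := by norm_num
  hθ₀2 := by norm_num

namespace parOdd

variable (p : ℕ) (hp : 3 ≤ p) {n : ℕ} (hn : 1 ≤ n) (V : Fin n → ℝ) (Vmax W : ℝ) (hV1 : ∀ j, 1 ≤ V j) (hVm : ∀ j, V j ≤ Vmax)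
  (hW : 1 ≤ W)

/-- field `p`. [folklore] -/
theorem p_eq : (parOdd p hp hn V Vmax W hV1 hVm hW).p = p := rfl
/-- field `A`. [folklore] -/
theorem A_eq : (parOdd p hp hn V Vmax W hV1 hVm hW).A = V := rfl
/-- field `Amax`. [folklore] -/
theorem Amax_eq : (parOdd p hp hn V Vmax W hV1 hVm hW).Amax = Vmax := rfl
/-- field `W`. [folklore] -/
theorem W_eq : (parOdd p hp hn V Vmax W hV1 hVm hW).W = W := rfl
/-- field `Nq`. [folklore] -/
theorem Nq_eq : (parOdd p hp hn V Vmax W hV1 hVm hW).Nq = 1 := rfl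
/-- field `K₀`. [folklore] -/
theorem K₀_eq : (parOdd p hp hn V Vmax W hV1 hVm hW).K₀ = p - 1 := rfl
/-- field `θ₀`. [folklore] -/
theorem θ₀_eq : (parOdd p hp hn V Vmax W hV1 hVm hW).θ₀ = 1 / 2 := rfl

end parOdd

end Summit.ABC.StewartYu

end
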